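import Mathlib

/-!
# Block volume cap for pairwise-orthogonal box legs (crux `ThinPackings`, stmt-MatrixMultiplication-10595)

Line `three-sphere-frame-designs`, stub `frameBlock_card_le` (worker for lead c2, 2026-08-16).

If the three legs `A, B, C ⊆ [-b, b]^D ∩ ℤ^D` of a block are pairwise orthogonal (every `x ∈ A` is orthogonal
to every `y ∈ B`, etc.), then `|A|·|B|·|C| ≤ (2b+1)^D`.

Proof.  The `ℚ`-spans `W_A, W_B, W_C ≤ ℚ^D` of the legs are pairwise orthogonal, hence `W_A ⊓ W_B = ⊥` and
`(W_A ⊔ W_B) ⊓ W_C = ⊥` (a vector orthogonal to itself vanishes, `dotProduct_self_eq_zero`), so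
`dim W_A + dim W_B + dim W_C ≤ D`.  A subspace `W ≤ ℚ^D` of dimension `d` contains at most `(2b+1)^d`
integer points of the box: the coordinate functionals restricted to `W` span `W*`, so a linearly independent
spanning subfamily, indexed by a coordinate set `s` with `|s| ≤ dim W* = d`, already separates the points of
`W`; restriction to the coordinates in `s` is therefore injective on `W`, with values in `[-b, b]^s`.
Multiply the three bounds.  Elementary and sorry-free; Mathlib only.
-/

set_option linter.dupNamespace false  -- `Summit.<S>.<S>.…` is the mandated namespace

namespace Summit.MatrixMultiplication.MatrixMultiplication.Theorems.ThinPackings.Negative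

open Finset Module

section FrameBlockVolume

variable {D : ℕ}

/-- The coordinatewise cast `ℤ^D → ℚ^D`, `v ↦ Int.cast ∘ v`, is injective. [folklore] -/
theorem intCastVec_injective :
    Function.Injective (Function.comp (Int.cast : ℤ → ℚ) : (Fin D → ℤ) → Fin D → ℚ) := by
  intro v w h
  funext t
  have := congr_fun h t
  simpa using this

/-- The coordinatewise cast `ℤ^D → ℚ^D` commutes with the dot product. [folklore] -/
theorem intCastVec_dotProduct (x y : Fin D → ℤ) :
    ((Int.cast : ℤ → ℚ) ∘ x) ⬝ᵥ ((Int.cast : ℤ → ℚ) ∘ y) = ((x ⬝ᵥ y : ℤ) : ℚ) := by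
  simp [dotProduct]

/-- Pointwise orthogonality of two sets of vectors extends bilinearly to their spans. [folklore] -/
theorem span_dotProduct_eq_zero (P Q : Set (Fin D → ℚ)) (h : ∀ p ∈ P, ∀ q ∈ Q, p ⬝ᵥ q = 0) :
    ∀ u ∈ Submodule.span ℚ P, ∀ v ∈ Submodule.span ℚ Q, u ⬝ᵥ v = 0 := by
  have inner : ∀ p ∈ P, ∀ v ∈ Submodule.span ℚ Q, p ⬝ᵥ v = 0 := by
    intro p hp v hv
    induction hv using Submodule.span_induction with
    | mem q hq => exact h p hp q hq
    | zero => exact dotProduct_zero _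
    | add v w _ _ h1 h2 => rw [dotProduct_add, h1, h2, add_zero]
    | smul c v _ h1 => rw [dotProduct_smul, h1, smul_zero]
  intro u hu v hv
  induction hu using Submodule.span_induction with
  | mem p hp => exact inner p hp v hv
  | zero => exact zero_dotProduct _
  | add u u' _ _ h1 h2 => rw [add_dotProduct, h1, h2, add_zero]
  | smul c u _ h1 => rw [smul_dotProduct, h1, smul_zero]

/-- The casts of two pointwise-orthogonal finite sets of integer vectors are pointwise orthogonal in `ℚ^D`.
[folklore] -/
theorem image_dotProduct_eq_zero (X Y : Finset (Fin D → ℤ)) (h : ∀ x ∈ X, ∀ y ∈ Y, x ⬝ᵥ y = 0) :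
    ∀ p ∈ Function.comp (Int.cast : ℤ → ℚ) '' (X : Set (Fin D → ℤ)),
      ∀ q ∈ Function.comp (Int.cast : ℤ → ℚ) '' (Y : Set (Fin D → ℤ)), p ⬝ᵥ q = 0 := by
  rintro _ ⟨x, hx, rfl⟩ _ ⟨y, hy, rfl⟩
  rw [intCastVec_dotProduct, h x (Finset.mem_coe.1 hx) y (Finset.mem_coe.1 hy), Int.cast_zero]

/-- Orthogonal subspaces of `ℚ^D` are disjoint: a vector orthogonal to itself vanishes. [folklore] -/
theorem disjoint_of_dotProduct_eq_zero {U V : Submodule ℚ (Fin D → ℚ)}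
    (h : ∀ u ∈ U, ∀ v ∈ V, u ⬝ᵥ v = 0) : Disjoint U V := by
  rw [Submodule.disjoint_def]
  intro w hwU hwV
  exact dotProduct_self_eq_zero.1 (h w hwU w hwV)

/-- **Box count in a subspace.**  A subspace `W ≤ ℚ^D` contains at most `(2b+1)^{dim W}` integer points of
the box `[-b, b]^D`: some `dim W` coordinates already determine a point of `W`. [folklore] -/
theorem card_le_pow_finrank_of_mem (b : ℕ) (W : Submodule ℚ (Fin D → ℚ)) (S : Finset (Fin D → ℤ))
    (hW : ∀ v ∈ S, (Int.cast : ℤ → ℚ) ∘ v ∈ W) (hb : ∀ v ∈ S, ∀ t, |v t| ≤ (b : ℤ)) :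
    S.card ≤ (2 * b + 1) ^ finrank ℚ W := by
  classical
  -- the coordinate functionals restricted to `W`
  obtain ⟨f, hf⟩ : ∃ f : Fin D → Module.Dual ℚ W, ∀ j (w : W), f j w = (w : Fin D → ℚ) j :=
    ⟨fun j => (LinearMap.proj j).comp W.subtype, fun _ _ => rfl⟩
  -- an independent spanning subfamily, indexed by a coordinate set `s`
  obtain ⟨s, -, -, hspan, hli⟩ :=
    exists_linearIndepOn_extension (linearIndepOn_empty ℚ f) (Set.empty_subset (Set.univ : Set (Fin D)))
  have hcard : Fintype.card s ≤ finrank ℚ W := by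
    have h := LinearIndependent.fintype_card_le_finrank hli
    rwa [Subspace.dual_finrank_eq] at h
  -- the coordinates in `s` separate the points of `W`
  have hsep : ∀ w ∈ W, (∀ j ∈ s, w j = 0) → w = 0 := by
    intro w hw hz
    funext j
    have hj : f j ∈ Submodule.span ℚ (f '' s) := hspan ⟨j, Set.mem_univ _, rfl⟩
    have key : ∀ φ ∈ Submodule.span ℚ (f '' s), φ ⟨w, hw⟩ = 0 := by
      intro φ hφ
      induction hφ using Submodule.span_induction with
      | mem φ hφ =>
        obtain ⟨i, hi, rfl⟩ := hφ
        rw [hf]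
        exact hz i hi
      | zero => rfl
      | add φ ψ _ _ h1 h2 => rw [LinearMap.add_apply, h1, h2, add_zero]
      | smul c φ _ h1 => rw [LinearMap.smul_apply, h1, smul_zero]
    have := key (f j) hj
    rw [hf] at this
    exact this
  -- restriction to the coordinates in `s` is injective on `S` and lands in the box `[-b, b]^s`
  have hinj : Set.InjOn (fun (v : Fin D → ℤ) (j : s) => v j) ↑S := by
    intro v hv v' hv' he
    have h0 : (Int.cast : ℤ → ℚ) ∘ v - (Int.cast : ℤ → ℚ) ∘ v' = 0 := by
      refine hsep _ (W.sub_mem (hW v hv) (hW v' hv')) fun j hj => ?_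
      have hej : v j = v' j := congr_fun he ⟨j, hj⟩
      simp [hej]
    exact intCastVec_injective (sub_eq_zero.1 h0)
  have hmaps : Set.MapsTo (fun (v : Fin D → ℤ) (j : s) => v j) ↑S
      ↑(Fintype.piFinset fun _ : s => Finset.Icc (-(b : ℤ)) b) := by
    intro v hv
    rw [Finset.mem_coe, Fintype.mem_piFinset]
    intro j
    rw [Finset.mem_Icc]
    exact abs_le.1 (hb v hv j)
  calc S.card ≤ (Fintype.piFinset fun _ : s => Finset.Icc (-(b : ℤ)) b).card :=
        Finset.card_le_card_of_injOn _ hmaps hinj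
    _ = (2 * b + 1) ^ Fintype.card s := by
        rw [Fintype.card_piFinset, Finset.prod_const, Finset.card_univ, Int.card_Icc]
        congr 1
        omega
    _ ≤ (2 * b + 1) ^ finrank ℚ W := Nat.pow_le_pow_right (by omega) hcard

/-- **Block volume cap.**  If the three legs `A, B, C` of a block in the box `[-b, b]^D ∩ ℤ^D` are pairwise
orthogonal, then `|A|·|B|·|C| ≤ (2b+1)^D`: the spans are pairwise orthogonal, hence independent, so their
dimensions add up to at most `D`, and each leg has at most `(2b+1)^{dim}` points (`card_le_pow_finrank_of_mem`).
[new, elementary] -/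
theorem frameBlock_card_le :
    ∀ (D b : ℕ) (A B C : Finset (Fin D → ℤ)), (∀ v ∈ A, ∀ t, |v t| ≤ (b : ℤ)) →
      (∀ v ∈ B, ∀ t, |v t| ≤ (b : ℤ)) → (∀ v ∈ C, ∀ t, |v t| ≤ (b : ℤ)) →
      (∀ x ∈ A, ∀ y ∈ B, x ⬝ᵥ y = 0) → (∀ x ∈ A, ∀ z ∈ C, x ⬝ᵥ z = 0) →
      (∀ y ∈ B, ∀ z ∈ C, y ⬝ᵥ z = 0) → A.card * B.card * C.card ≤ (2 * b + 1) ^ D := by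
  intro D b A B C hA hB hC hAB hAC hBC
  set WA : Submodule ℚ (Fin D → ℚ) :=
    Submodule.span ℚ (Function.comp (Int.cast : ℤ → ℚ) '' (A : Set (Fin D → ℤ)))
  set WB : Submodule ℚ (Fin D → ℚ) :=
    Submodule.span ℚ (Function.comp (Int.cast : ℤ → ℚ) '' (B : Set (Fin D → ℤ)))
  set WC : Submodule ℚ (Fin D → ℚ) :=
    Submodule.span ℚ (Function.comp (Int.cast : ℤ → ℚ) '' (C : Set (Fin D → ℤ)))
  have oAB := span_dotProduct_eq_zero _ _ (image_dotProduct_eq_zero A B hAB)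
  have oAC := span_dotProduct_eq_zero _ _ (image_dotProduct_eq_zero A C hAC)
  have oBC := span_dotProduct_eq_zero _ _ (image_dotProduct_eq_zero B C hBC)
  -- pairwise orthogonal spans are independent
  have dAB : Disjoint WA WB := disjoint_of_dotProduct_eq_zero oAB
  have dABC : Disjoint (WA ⊔ WB) WC := by
    refine disjoint_of_dotProduct_eq_zero fun w hw z hz => ?_
    obtain ⟨u, hu, v, hv, rfl⟩ := Submodule.mem_sup.1 hw
    rw [add_dotProduct, oAC u hu z hz, oBC v hv z hz, add_zero]
  have hdim : finrank ℚ WA + finrank ℚ WB + finrank ℚ WC ≤ D := by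
    have h1 : finrank ℚ WA + finrank ℚ WB = finrank ℚ ↥(WA ⊔ WB) := by
      rw [← Submodule.finrank_sup_add_finrank_inf_eq, dAB.eq_bot, finrank_bot, add_zero]
    have h2 : finrank ℚ ↥(WA ⊔ WB) + finrank ℚ WC ≤ finrank ℚ (Fin D → ℚ) :=
      Submodule.finrank_add_finrank_le_of_disjoint dABC
    rw [Module.finrank_fin_fun] at h2
    omega
  -- each leg is counted inside its span
  have cA := card_le_pow_finrank_of_mem b WA A (fun v hv => Submodule.subset_span ⟨v, hv, rfl⟩) hA
  have cB := card_le_pow_finrank_of_mem b WB B (fun v hv => Submodule.subset_span ⟨v, hv, rfl⟩) hB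
  have cC := card_le_pow_finrank_of_mem b WC C (fun v hv => Submodule.subset_span ⟨v, hv, rfl⟩) hC
  calc A.card * B.card * C.card
      ≤ (2 * b + 1) ^ finrank ℚ WA * (2 * b + 1) ^ finrank ℚ WB * (2 * b + 1) ^ finrank ℚ WC :=
        Nat.mul_le_mul (Nat.mul_le_mul cA cB) cC
    _ = (2 * b + 1) ^ (finrank ℚ WA + finrank ℚ WB + finrank ℚ WC) := by rw [pow_add, pow_add]
    _ ≤ (2 * b + 1) ^ D := Nat.pow_le_pow_right (by omega) hdim

end FrameBlockVolume

end Summit.MatrixMultiplication.MatrixMultiplication.Theorems.ThinPackings.Negative
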